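import Summits.QuantumFields.BalabanUV.Beta.EriceRemainderEnclosureHistoryAutonomyAntitoneWitness
import Summits.QuantumFields.BalabanUV.Beta.EriceRemainderEnclosureHistoryAutonomyMonotoneGeneral

/-!
# EriceRemainderEnclosureHistoryAutonomyAntitoneThreshold — (E45b) THE THRESHOLD THEOREM FOR ANTITONE MEMORY: the set of ratios `M·γ∕b` of the
# non-unique instances whose functional is NON-INCREASING in the history is EXACTLY `]3√3, ∞[` — the same as for the whole zeroth-moment class
# and for the Markov class ((E38c)) — and at every such ratio an antitone Markov functional has a CONTINUUM of box solutions ((E45a)'s clamp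
# family); against (E43b) (NON-DECREASING memory of ANY size ⟹ unique): for monotone memory the DIRECTION decides, and the clamp functional
# is certified non-monotone-increasing by (E43b) itself

Cell `pub-balaban`, β-function sub-cell, BINDER row D4 «RemainderConst leaves for Bałaban's split» (`HOME/BINDER-OWNERS.md`; owner
lineage `b2b-balaban-beta-an4`; this file by co-owner #2 lineage `b2b-balaban-beta-d4-p2`, generation 41), β-FLOW TEAM duty (1),
FREEZE (0) honoured (def-free; (E45a) `…HistoryAutonomyAntitoneWitness`, (E38a) `…HistoryAutonomyThreshold.ratio_gt_of_two_solutions` and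
(E43b) `…HistoryAutonomyMonotoneGeneral.memFlow_unique_of_monotone_zm` BY NAME).

HONEST FRAMING (page 1, verbatim and binding).  *"Discharging BetaPertH makes Bałaban's UV stability UNCONDITIONAL — a real
constructive-QFT result; it is NOT the continuum limit and NOT the Clay problem."*  THIS FILE DISCHARGES NOTHING OF THE KIND.  ENDs over an
explicit toy family and the cell's own NOT-IN-PRINT binder shapes (zeroth moment, floor, box, pin); nothing of Bałaban's (1.22) asserted —
NOT its monotonicity, NOT its side of the threshold ([I] p. 298 qualitative; GAPS G-t4-U2-1∕-2).  Row D4 class UNCHANGED (critical-path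
width 0; instance 0∕1; D4 DISCHARGE NO DATE).  HONEST DEPENDENCY: continuum YM on T⁴ ⇐ BetaPertH ∧ nine spine estimates (0/9 proved);
BetaPertH ⇐ (D1) ∧ (D4) ∧ CAP+tail; G-an2-4 gates asym, D1 and NE2/3/4.

WHAT IS PROVED ([folklore]; 0 `def`, 0 sorry).  `level_choice_of_gt` (`τ > 3√3 ⟹ ∃ y ∈ ]0,1[, 6√3∕y³ < 2τ`; `y = (2+s)∕3`, `s = 3√3∕τ`,
`(2+s)³ − 27s = (s−1)²(s+8)`), **`exists_continuum_antitone_markov_of_gt`** ((E37i)∕(E38c)'s Markov binder shapes + ANTITONE, `L·γ < τ·b`, the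
solution set in bijection with a nondegenerate interval under `h ↦ 1∕h(1)²`), **`exists_continuum_antitone_of_gt`** ((E38a)'s functional binder
shapes + antitone in the history), **`antitoneRatioSet_eq_Ioi`** (`= Set.Ioi (3√3)`), `isGLB_antitoneRatioSet`, **`not_monotone_clampφ`** ((E43b)
refutes «non-decreasing» for the clamp functional on the box: the kernel's own certificate that the direction is the other one).
-/

noncomputable section
open Filter Topology Finset

namespace Summit.QuantumFields.BalabanUV.Beta.EriceRemainderEnclosureHistoryAutonomyAntitoneThreshold

open Literature.MathematicalPhysics.QuantumFieldTheory.Balaban1983to89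
open Literature.MathematicalPhysics.QuantumFieldTheory.Balaban1983to89.T4BetaStationary
open Literature.MathematicalPhysics.QuantumFieldTheory.Balaban1983to89.T4BetaFlowWellPosed
open Summit.QuantumFields.BalabanUV.Beta.EriceRemainderEnclosureHistoryAutonomyThreshold
open Summit.QuantumFields.BalabanUV.Beta.EriceRemainderEnclosureHistoryAutonomyThresholdWitness (three_le_three_div_sq)
open Summit.QuantumFields.BalabanUV.Beta.EriceRemainderEnclosureHistoryAutonomyAntitoneWitness
open Summit.QuantumFields.BalabanUV.Beta.EriceRemainderEnclosureHistoryAutonomyMonotoneGeneral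

variable {y : ℝ}

/-! ## Ends: at every ratio above `3√3` an ANTITONE functional with a continuum of box solutions -/

/-- THE PARAMETER CHOICE: for `τ > 3√3` there is `y ∈ ]0,1[` with `(6√3∕y³)·1 < τ·2` (`y = (2+s)∕3`, `s = 3√3∕τ`: `(2+s)³ − 27s = (s−1)²(s+8) > 0`).
[folklore] -/
theorem level_choice_of_gt {τ : ℝ} (hτ : 3 * Real.sqrt 3 < τ) :
    ∃ y : ℝ, 0 < y ∧ y < 1 ∧ 6 * Real.sqrt 3 / y ^ 3 * 1 < τ * 2 := by
  have h33 : 0 < 3 * Real.sqrt 3 := three_sqrt_three_pos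
  have hτ0 : 0 < τ := h33.trans hτ
  set s : ℝ := 3 * Real.sqrt 3 / τ with hs
  have hs0 : 0 < s := div_pos h33 hτ0
  have hs1 : s < 1 := (div_lt_one hτ0).2 hτ
  refine ⟨(2 + s) / 3, by positivity, by linarith, ?_⟩
  have hy0 : 0 < (2 + s) / 3 := by positivity
  have key : s < ((2 + s) / 3) ^ 3 := by nlinarith [mul_pos (mul_pos (sub_pos.2 hs1) (sub_pos.2 hs1)) (by linarith : (0 : ℝ) < s + 8)]
  have e : 3 * Real.sqrt 3 = s * τ := by rw [hs]; field_simp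
  rw [mul_one, div_lt_iff₀ (by positivity)]
  calc 6 * Real.sqrt 3 = 2 * (s * τ) := by rw [← e]; ring
    _ < 2 * (((2 + s) / 3) ^ 3 * τ) := by nlinarith [mul_pos hτ0 (sub_pos.2 key)]
    _ = τ * 2 * ((2 + s) / 3) ^ 3 := by ring

/-- **EVERY RATIO ABOVE `3√3` CARRIES AN ANTITONE MARKOV FLOW WITH A CONTINUUM OF BOX SOLUTIONS** — in the binder shapes of (E37i) ∕ (E38c)
(`φ` `L`-Lipschitz with floor `b` on ]0,γ], pin in ]0,γ]) plus ANTITONE, with `L·γ < τ·b`: the solution set maps bijectively onto a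
nondegenerate interval under `h ↦ 1∕h(1)²`. [folklore] -/
theorem exists_continuum_antitone_markov_of_gt {τ : ℝ} (hτ : 3 * Real.sqrt 3 < τ) :
    ∃ (φ : ℝ → ℝ) (L γ b gIR : ℝ),
      (∀ x x', 0 < x → x ≤ γ → 0 < x' → x' ≤ γ → |φ x - φ x'| ≤ L * |x - x'|) ∧ 0 ≤ L ∧ 0 < gIR ∧ gIR ≤ γ ∧
      0 < b ∧ (∀ x, 0 < x → x ≤ γ → b ≤ φ x) ∧ (∀ x x', 0 < x → x ≤ x' → x' ≤ γ → φ x' ≤ φ x) ∧ L * γ < τ * b ∧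
      ∃ t₁ t₂ : ℝ, t₁ < t₂ ∧ Set.BijOn (fun h : ℕ → ℝ => 1 / h 1 ^ 2)
        {h | SeqBox γ h ∧ MemFlow (fun u => φ (u 0)) gIR h} (Set.Icc t₁ t₂) := by
  obtain ⟨y, hy0, hy1, hlt⟩ := level_choice_of_gt hτ
  have h3 : (3 : ℝ) < 3 / y ^ 2 := by
    rw [lt_div_iff₀ (by positivity)]; nlinarith [mul_pos hy0 hy0]
  exact ⟨(fun x : ℝ => max (1 / (max x (y / Real.sqrt 3)) ^ 2 - 1) 2), 6 * Real.sqrt 3 / y ^ 3, 1, 2, 1,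
    fun x x' _ _ _ _ => abs_clampφ_sub_le hy0 x x', by positivity, one_pos, le_rfl, two_pos, fun x _ _ => two_le_clampφ y x,
    fun x x' _ hxx' _ => clampφ_antitone hy0 hxx', hlt, 3, 3 / y ^ 2, h3, bijOn_solutionSet hy0 hy1.le⟩

/-- **THE SAME IN THE BINDER SHAPES OF (E38a) ∕ (E43)** (a functional with zeroth moment `M`, floor `b` on the box ]0,γ]^ℕ, one pin) plus
ANTITONE IN THE HISTORY (`u ≤ v ⟹ B v ≤ B u`): at every ratio `M·γ∕b < τ`, `τ > 3√3` arbitrary, a continuum of box solutions —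
against (E43) `memFlow_unique_of_monotone_zm` (NON-DECREASING ⟹ unique at ANY ratio): the direction of monotonicity decides. [folklore] -/
theorem exists_continuum_antitone_of_gt {τ : ℝ} (hτ : 3 * Real.sqrt 3 < τ) :
    ∃ (B : (ℕ → ℝ) → ℝ) (M γ b gIR : ℝ),
      (∀ u u' : ℕ → ℝ, SeqBox γ u → SeqBox γ u' → ∀ D : ℝ, (∀ j, |u j - u' j| ≤ D) → |B u - B u'| ≤ M * D) ∧
      0 ≤ M ∧ 0 < gIR ∧ gIR ≤ γ ∧ 0 < b ∧ (∀ u, SeqBox γ u → b ≤ B u) ∧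
      (∀ u v : ℕ → ℝ, SeqBox γ u → SeqBox γ v → (∀ j, u j ≤ v j) → B v ≤ B u) ∧ M * γ < τ * b ∧
      ∃ t₁ t₂ : ℝ, t₁ < t₂ ∧ Set.BijOn (fun h : ℕ → ℝ => 1 / h 1 ^ 2)
        {h | SeqBox γ h ∧ MemFlow B gIR h} (Set.Icc t₁ t₂) := by
  obtain ⟨φ, L, γ, b, gIR, hL, hL0, hgIR, hgIRγ, hb, hlo, hanti, hlt, t₁, t₂, ht, hbij⟩ :=
    exists_continuum_antitone_markov_of_gt hτ
  refine ⟨fun u => φ (u 0), L, γ, b, gIR, fun u u' hu hu' D hD => ?_, hL0, hgIR, hgIRγ, hb,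
    fun u hu => hlo (u 0) (hu 0).1 (hu 0).2, fun u v hu hv huv => hanti (u 0) (v 0) (hu 0).1 (huv 0) (hv 0).2, hlt,
    t₁, t₂, ht, hbij⟩
  exact (hL (u 0) (u' 0) (hu 0).1 (hu 0).2 (hu' 0).1 (hu' 0).2).trans (mul_le_mul_of_nonneg_left (hD 0) hL0)

/-- **THE THRESHOLD THEOREM FOR THE ANTITONE CLASS.**  The set of ratios `M·γ∕b` over the non-unique instances whose functional is ANTITONE in
the history (zeroth moment `M ≥ 0`, floor `b > 0` on ]0,γ], one pin, two distinct box solutions) IS EXACTLY `]3√3, ∞[` — the same as for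
the whole memory class and for the Markov class ((E38c) `ratioSet_eq_Ioi` ∕ `markovRatioSet_eq_Ioi`): restricting to antitone memory does
NOT raise the threshold, while restricting to non-decreasing memory removes it ((E43)). [folklore] -/
theorem antitoneRatioSet_eq_Ioi :
    {r : ℝ | ∃ (B : (ℕ → ℝ) → ℝ) (M γ b gIR : ℝ) (h h' : ℕ → ℝ),
      (∀ u u' : ℕ → ℝ, SeqBox γ u → SeqBox γ u' → ∀ D : ℝ, (∀ j, |u j - u' j| ≤ D) → |B u - B u'| ≤ M * D) ∧
      0 ≤ M ∧ 0 < gIR ∧ gIR ≤ γ ∧ 0 < b ∧ (∀ u, SeqBox γ u → b ≤ B u) ∧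
      (∀ u v : ℕ → ℝ, SeqBox γ u → SeqBox γ v → (∀ j, u j ≤ v j) → B v ≤ B u) ∧ SeqBox γ h ∧ SeqBox γ h' ∧
      MemFlow B gIR h ∧ MemFlow B gIR h' ∧ h ≠ h' ∧ r = M * γ / b} = Set.Ioi (3 * Real.sqrt 3) := by
  ext r
  constructor
  · rintro ⟨B, M, γ, b, gIR, h, h', hB, hM, hgIR, hgIRγ, hb, hlo, -, hh, hh', hf, hf', hne, rfl⟩
    rw [Set.mem_Ioi, lt_div_iff₀ hb]
    exact ratio_gt_of_two_solutions hB hM hgIR hgIRγ hb hlo hh hh' hf hf' hne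
  · intro hr
    obtain ⟨B, M, γ, b, gIR, hB, hM, hgIR, hgIRγ, hb, hlo, hanti, hlt, t₁, t₂, ht, hbij⟩ :=
      exists_continuum_antitone_of_gt (Set.mem_Ioi.1 hr)
    have hγ : 0 < γ := lt_of_lt_of_le hgIR hgIRγ
    have hMle : M ≤ r * b / γ := by rw [le_div_iff₀ hγ]; exact hlt.le
    -- two distinct solutions: the preimages of the two ends of the interval
    obtain ⟨h, hhS, hh1⟩ := hbij.surjOn (Set.left_mem_Icc.2 ht.le)
    obtain ⟨h', hh'S, hh'1⟩ := hbij.surjOn (Set.right_mem_Icc.2 ht.le)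
    have hne : h ≠ h' := fun e => by
      simp only at hh1 hh'1
      rw [e, hh'1] at hh1
      exact ht.ne' hh1
    refine ⟨B, r * b / γ, γ, b, gIR, h, h', fun u u' hu hu' D hD => ?_, hM.trans hMle, hgIR, hgIRγ, hb, hlo, hanti,
      hhS.1, hh'S.1, hhS.2, hh'S.2, hne, by field_simp⟩
    exact (hB u u' hu hu' D hD).trans (mul_le_mul_of_nonneg_right hMle ((abs_nonneg _).trans (hD 0)))


/-- `3√3` is the infimum of the antitone ratio set and is NOT attained. [folklore] -/
theorem isGLB_antitoneRatioSet :
    IsGLB {r : ℝ | ∃ (B : (ℕ → ℝ) → ℝ) (M γ b gIR : ℝ) (h h' : ℕ → ℝ),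
      (∀ u u' : ℕ → ℝ, SeqBox γ u → SeqBox γ u' → ∀ D : ℝ, (∀ j, |u j - u' j| ≤ D) → |B u - B u'| ≤ M * D) ∧
      0 ≤ M ∧ 0 < gIR ∧ gIR ≤ γ ∧ 0 < b ∧ (∀ u, SeqBox γ u → b ≤ B u) ∧
      (∀ u v : ℕ → ℝ, SeqBox γ u → SeqBox γ v → (∀ j, u j ≤ v j) → B v ≤ B u) ∧ SeqBox γ h ∧ SeqBox γ h' ∧
      MemFlow B gIR h ∧ MemFlow B gIR h' ∧ h ≠ h' ∧ r = M * γ / b} (3 * Real.sqrt 3) ∧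
    (3 * Real.sqrt 3) ∉ {r : ℝ | ∃ (B : (ℕ → ℝ) → ℝ) (M γ b gIR : ℝ) (h h' : ℕ → ℝ),
      (∀ u u' : ℕ → ℝ, SeqBox γ u → SeqBox γ u' → ∀ D : ℝ, (∀ j, |u j - u' j| ≤ D) → |B u - B u'| ≤ M * D) ∧
      0 ≤ M ∧ 0 < gIR ∧ gIR ≤ γ ∧ 0 < b ∧ (∀ u, SeqBox γ u → b ≤ B u) ∧
      (∀ u v : ℕ → ℝ, SeqBox γ u → SeqBox γ v → (∀ j, u j ≤ v j) → B v ≤ B u) ∧ SeqBox γ h ∧ SeqBox γ h' ∧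
      MemFlow B gIR h ∧ MemFlow B gIR h' ∧ h ≠ h' ∧ r = M * γ / b} := by
  rw [antitoneRatioSet_eq_Ioi]
  exact ⟨isGLB_Ioi, fun h => lt_irrefl _ (Set.mem_Ioi.1 h)⟩

/-- **THE KERNEL'S OWN CERTIFICATE OF THE DIRECTION**: the clamp functional `u ↦ φ_y(u 0)` (`0 < y < 1`) is NOT non-decreasing in the history
on the box ]0,1]^ℕ — for (E43b) `memFlow_unique_of_monotone_zm` would then make its flow from the pin `1` uniquely solvable, against
(E45a)'s two named solutions `h⁽³⁾ ≠ h⁽³∕ʸ²⁾`. [folklore] -/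
theorem not_monotone_clampφ (hy0 : 0 < y) (hy1 : y < 1) :
    ¬ ∀ u v : ℕ → ℝ, SeqBox 1 u → SeqBox 1 v → (∀ j, u j ≤ v j) →
      (fun u : ℕ → ℝ => max (1 / (max (u 0) (y / Real.sqrt 3)) ^ 2 - 1) 2) u
        ≤ (fun u : ℕ → ℝ => max (1 / (max (u 0) (y / Real.sqrt 3)) ^ 2 - 1) 2) v := by
  intro hmono
  have h3 : (3 : ℝ) ≤ 3 / y ^ 2 := three_le_three_div_sq hy0 hy1.le
  exact hT_three_ne hy0 hy1 (memFlow_unique_of_monotone_zm (γ := 1) (gIR := 1) (b := 2) (M := 6 * Real.sqrt 3 / y ^ 3) hmono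
    (fun u u' _ _ D hD => zerothMoment_clampφ hy0 u u' D hD) (by positivity) one_pos two_pos (fun u _ => two_le_clampφ y (u 0))
    (seqBox_hT hy0 hy1.le le_rfl) (seqBox_hT hy0 hy1.le h3) (memFlow_hT hy0 hy1.le le_rfl h3)
    (memFlow_hT hy0 hy1.le h3 le_rfl))

end Summit.QuantumFields.BalabanUV.Beta.EriceRemainderEnclosureHistoryAutonomyAntitoneThreshold

end
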